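import Literature.Probability.RandomPlanarGeometry.SAWWordBridges
import Literature.Probability.RandomPlanarGeometry.SAWBridgeRadius
import Mathlib
import HarnessLib

/-!
# Stub `chainSpanMass_eq_tsum_tuples` (F1 of B′u) of crux `ConfinementPositivity`
# (stmt-CriticalPhenomena-17587), line `Sketch` (sign-universality): chains as tuples

A pure re-indexing dictionary.  The line's stub B′u ("unpinned slab tube") is stated over Kesten
CHAINS presented as lists `l : List (List Step)` of irreducible bridge words with total span
`(l.map xEnd).sum = L` and an arbitrary side condition `Q l`, weighted by
`x_c ^ (total length)`; its two engines (the cosine tube comparison and the chain Markov budget)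
are stated over TUPLES `Fin k → {w // IsIrrBridge w}` weighted by `∏ i, x_c ^ |wᵢ|`.  This file
proves the identity between the two presentations:

`chainSpanMass_eq_tsum_tuples : ∑' l : {l // (∀ w ∈ l, IsIrrBridge w) ∧ (l.map xEnd).sum = L ∧ Q l},
    ofReal (x_c ^ (l.map length).sum)
  = ∑' k, ∑' f : Fin k → {w // IsIrrBridge w},
    if (∑ i, xEnd (f i) = L ∧ Q (ofFn (val ∘ f))) then ∏ i, ofReal (x_c ^ |f i|) else 0`.

## Proof

All sums are in `ℝ≥0∞`, so no summability is needed.  (1) The subtype `tsum` on the left is the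
`tsum` over all `l : List (List Step)` of the extension by zero (`tsum_subtype`).  (2) That
function is supported on lists of irreducible bridges, i.e. on the range of the injection
`List.map Subtype.val : List {w // IsIrrBridge w} → List (List Step)`, so the sum is re-indexed by
`List {w // IsIrrBridge w}` (`Function.Injective.tsum_eq`, preimages built with `List.pmap`).
(3) `List.equivSigmaTuple : List α ≃ Σ k, Fin k → α` (`Equiv.tsum_eq`) and `ENNReal.tsum_sigma'`
turn it into the iterated sum over `k` and `f : Fin k → _`.  (4) Termwise, `List.map_ofFn`,
`List.sum_ofFn`, `Finset.prod_pow_eq_pow_sum` and `ENNReal.ofReal_prod_of_nonneg`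
(with `0 ≤ x_c`, `criticalFugacity_pos`) identify the conditions and the weights.

Elementary bookkeeping over Mathlib; nothing about self-avoiding walks is used beyond the
vocabulary (`Step`, `xEnd`, `IsIrrBridge`, `criticalFugacity`).  No `def`s.
-/

noncomputable section
open scoped BigOperators ENNReal
open Classical
open Literature.Probability.RandomPlanarGeometry Literature.Probability.RandomPlanarGeometry.SAW
open Literature.Probability.LatticeModels

namespace Summit.CriticalPhenomena.SAWScalingLimit.Theorems

/-- In `ℝ≥0∞`, a `tsum` over a subtype `{x // P x}` is the `tsum` over the ambient type of the
extension by zero, written with `if … then … else 0`. -/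
theorem chainTuples_tsum_subtype_eq_tsum_ite {β : Type*} (P : β → Prop) [DecidablePred P]
    (g : β → ℝ≥0∞) : ∑' x : {x // P x}, g x.1 = ∑' x, if P x then g x else 0 := by
  rw [show (∑' x : {x // P x}, g x.1) = ∑' x : (setOf P), g x from rfl, tsum_subtype]
  refine tsum_congr fun x => ?_
  simp only [Set.indicator_apply, Set.mem_setOf_eq]

/-- A list all of whose members satisfy `P` is in the range of
`List.map Subtype.val : List {a // P a} → List α`. -/
theorem chainTuples_mem_range_map_val {α : Type*} {P : α → Prop} (l : List α)
    (hl : ∀ a ∈ l, P a) : l ∈ Set.range (List.map (Subtype.val : {a // P a} → α)) := by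
  refine ⟨l.pmap Subtype.mk hl, ?_⟩
  rw [List.map_pmap]
  exact List.pmap_eq_self.2 fun _ _ => rfl

/-- The weight of a tuple chain: `x_c ^ (total length of List.ofFn g) = ∏ i, x_c ^ |g i|` after
`ENNReal.ofReal` (uses `0 ≤ x_c`, from `criticalFugacity_pos`). -/
theorem chainTuples_weight_ofFn (k : ℕ) (g : Fin k → List Step) :
    ENNReal.ofReal (criticalFugacity ^ ((List.ofFn g).map List.length).sum) =
      ∏ i, ENNReal.ofReal (criticalFugacity ^ (g i).length) := by
  rw [List.map_ofFn, List.sum_ofFn, ← Finset.prod_pow_eq_pow_sum,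
    ENNReal.ofReal_prod_of_nonneg fun i _ => pow_nonneg criticalFugacity_pos.le _]
  rfl

/-- **F1 (chains as tuples).**  For every side condition `Q` on the list of pieces and every span
`L`, the `x_c`-mass of Kesten chains (lists of irreducible bridge words) of total span `L`
satisfying `Q` equals the iterated sum over the number of pieces `k` and the tuples
`f : Fin k → {w // IsIrrBridge w}` of the product weight, restricted to total span `L` and
`Q (List.ofFn (val ∘ f))`. -/
theorem chainSpanMass_eq_tsum_tuples : ∀ (Q : List (List Step) → Prop) (L : ℤ),
    (∑' l : {l : List (List Step) // (∀ w ∈ l, IsIrrBridge w) ∧ (l.map xEnd).sum = L ∧ Q l},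
        ENNReal.ofReal (criticalFugacity ^ (l.1.map List.length).sum)) =
      ∑' k : ℕ, ∑' f : Fin k → {w : List Step // IsIrrBridge w},
        if ((∑ i, xEnd (f i).1) = L ∧ Q (List.ofFn fun i => (f i).1)) then
          ∏ i, ENNReal.ofReal (criticalFugacity ^ (f i).1.length) else 0 := by
  intro Q L
  -- the extension by zero of the summand to all lists of words
  set F : List (List Step) → ℝ≥0∞ := fun l =>
    if ((∀ w ∈ l, IsIrrBridge w) ∧ (l.map xEnd).sum = L ∧ Q l) then
      ENNReal.ofReal (criticalFugacity ^ (l.map List.length).sum) else 0 with hF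
  -- (1) subtype sum = sum of the extension by zero
  have h1 : (∑' l : {l : List (List Step) //
      (∀ w ∈ l, IsIrrBridge w) ∧ (l.map xEnd).sum = L ∧ Q l},
        ENNReal.ofReal (criticalFugacity ^ (l.1.map List.length).sum)) = ∑' l, F l :=
    chainTuples_tsum_subtype_eq_tsum_ite
      (fun l : List (List Step) => (∀ w ∈ l, IsIrrBridge w) ∧ (l.map xEnd).sum = L ∧ Q l)
      (fun l => ENNReal.ofReal (criticalFugacity ^ (l.map List.length).sum))
  -- (2) re-index by lists of irreducible bridges
  have h2 : ∑' m : List {w : List Step // IsIrrBridge w}, F (m.map Subtype.val) = ∑' l, F l := by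
    apply Function.Injective.tsum_eq (List.map_injective_iff.2 Subtype.val_injective)
    intro l hl
    apply chainTuples_mem_range_map_val
    by_contra hA
    have hFl : F l = 0 := by
      simp only [hF]
      exact if_neg fun h => hA h.1
    exact (Function.mem_support.1 hl) hFl
  -- (3) re-index by sigma tuples
  have h3 : ∑' p : Σ k, Fin k → {w : List Step // IsIrrBridge w},
      F ((List.ofFn p.2).map Subtype.val) =
        ∑' m : List {w : List Step // IsIrrBridge w}, F (m.map Subtype.val) :=
    List.equivSigmaTuple.symm.tsum_eq (fun m => F (m.map Subtype.val))
  rw [h1, ← h2, ← h3, ENNReal.tsum_sigma']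
  refine tsum_congr fun k => tsum_congr fun f => ?_
  -- (4) termwise identification
  have hA : ∀ w ∈ List.ofFn (fun i => (f i).1), IsIrrBridge w :=
    List.forall_mem_ofFn_iff.2 fun i => (f i).2
  have hmap : (List.ofFn f).map Subtype.val = List.ofFn fun i => (f i).1 := by
    rw [List.map_ofFn]
    rfl
  have hsum : ((List.ofFn fun i => (f i).1).map xEnd).sum = ∑ i, xEnd (f i).1 := by
    rw [List.map_ofFn, List.sum_ofFn]
    rfl
  simp only [hF, hmap, hsum]
  by_cases hBQ : (∑ i, xEnd (f i).1) = L ∧ Q (List.ofFn fun i => (f i).1)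
  · rw [if_pos ⟨hA, hBQ⟩, if_pos hBQ]
    exact chainTuples_weight_ofFn k fun i => (f i).1
  · rw [if_neg (fun h => hBQ h.2), if_neg hBQ]

end Summit.CriticalPhenomena.SAWScalingLimit.Theorems
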